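import Mathlib
import Literature.Computability.AlgebraicComplexity.FastFourierTransform
import Literature.Computability.AlgebraicComplexity.DivisionSLP

/-!
# FFT cost in the `Derivable` model (glue of line `Sketch`, crux `HiddenToeplitzCorners.ToeplitzLikeDetCost`,
# stmt-MatrixMultiplication-7491)

The radix-2 decimation-in-frequency FFT of the tree (`fft`, GG Algorithm 8.14) on `2^κ` inputs costs
`κ · 2^κ` linear steps in the straight-line-program-with-division model `Derivable` (one butterfly
output `u ± ω^l v` is ONE step there; constants are free). Consumed by the landed stubs
`stub_polyMulCost`, `stub_cauchyMatvec`, `stub_conversion` of the crux as their hypothesis `hfft`.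
-/

set_option linter.dupNamespace false

namespace Summit.MatrixMultiplication.MatrixMultiplication.Theorems

open scoped BigOperators
open Literature.Computability.AlgebraicComplexity

noncomputable section

section KLevel

variable {K : Type} [Field K] [Algebra ℂ K]

/-- **Cost of the FFT** (GG Thm 8.15, cost half, in the `Derivable` model where one butterfly output
`u ± ω^l v` is ONE linear step): all `2^κ` outputs `fft κ ω a j` of the tree's radix-2
decimation-in-frequency FFT are derivable from the inputs `a i` (`i < 2^κ`) in `κ · 2^κ` steps, for
any constant `ω`. Induction on `κ` along the definition of `fft`. [cite: GathenGerhard2013, §8.2 Thm 8.15] -/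
theorem fftCost (κ : ℕ) : ∀ (ω : ℂ) (a : ℕ → K) (A : Set K),
    (∀ i < 2 ^ κ, a i ∈ A ∪ Set.range (algebraMap ℂ K)) →
    Derivable ℂ (κ * 2 ^ κ) A {v | ∃ j < 2 ^ κ, v = fft κ (algebraMap ℂ K ω) a j} := by
  induction κ with
  | zero =>
    intro ω a A ha
    refine Derivable.of_subset ?_ _
    rintro v ⟨j, hj, rfl⟩
    have hj0 : j = 0 := by omega
    subst hj0
    simpa [fft] using ha 0 (by norm_num)
  | succ κ ih =>
    intro ω a A ha
    set ωK : K := algebraMap ℂ K ω with hωK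
    -- the two half-length inputs of the recursive calls
    set b : ℕ → K := fun l => a l + a (2 ^ κ + l) with hb
    set c : ℕ → K := fun l => (a l - a (2 ^ κ + l)) * ωK ^ l with hc
    -- step 1: all `b l`, `c l` (`l < 2^κ`) in `2 · 2^κ` linear steps
    have hB : Derivable ℂ (2 ^ κ) A {v | ∃ l < 2 ^ κ, v = b l} := by
      have h := Derivable.biUnion (k := ℂ) (Finset.range (2 ^ κ)) (c := fun _ => 1) (A := A)
        (B := fun l => {b l}) (fun l hl => by
          have hl' := Finset.mem_range.1 hl
          simpa [hb] using Derivable.add (k := ℂ) (A := A) (ha l (by rw [pow_succ]; omega))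
            (ha (2 ^ κ + l) (by rw [pow_succ]; omega)))
      refine h.mono (by simp) le_rfl ?_
      rintro v ⟨l, hl, rfl⟩
      exact Set.mem_biUnion (Finset.mem_range.2 hl) rfl
    have hC : Derivable ℂ (2 ^ κ) A {v | ∃ l < 2 ^ κ, v = c l} := by
      have h := Derivable.biUnion (k := ℂ) (Finset.range (2 ^ κ)) (c := fun _ => 1) (A := A)
        (B := fun l => {c l}) (fun l hl => by
          have hl' := Finset.mem_range.1 hl
          have h1 := Derivable.lin (k := ℂ) (A := A) (ha l (by rw [pow_succ]; omega))
            (ha (2 ^ κ + l) (by rw [pow_succ]; omega)) (ω ^ l) (-(ω ^ l))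
          have : (ω ^ l) • a l + (-(ω ^ l)) • a (2 ^ κ + l) = c l := by
            simp only [hc, hωK, Algebra.smul_def, map_pow, map_neg]
            ring
          rwa [this] at h1)
      refine h.mono (by simp) le_rfl ?_
      rintro v ⟨l, hl, rfl⟩
      exact Set.mem_biUnion (Finset.mem_range.2 hl) rfl
    have hBC : Derivable ℂ (2 ^ κ + 2 ^ κ) A ({v | ∃ l < 2 ^ κ, v = b l} ∪ {v | ∃ l < 2 ^ κ, v = c l}) :=
      hB.union hC
    -- step 2: the two recursive transforms with `ω²`
    set A' : Set K := A ∪ ({v | ∃ l < 2 ^ κ, v = b l} ∪ {v | ∃ l < 2 ^ κ, v = c l}) with hA'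
    have hω2 : algebraMap ℂ K (ω * ω) = ωK * ωK := by rw [map_mul]
    have ihb := ih (ω * ω) b A' (fun i hi => Or.inl (Or.inr (Or.inl ⟨i, hi, rfl⟩)))
    have ihc := ih (ω * ω) c A' (fun i hi => Or.inl (Or.inr (Or.inr ⟨i, hi, rfl⟩)))
    rw [hω2] at ihb ihc
    have hrec := ihb.union ihc
    have htot := hBC.trans hrec
    refine htot.mono ?_ le_rfl ?_
    · rw [pow_succ]; ring_nf; omega
    · rintro v ⟨j, hj, rfl⟩
      have hj2 : j / 2 < 2 ^ κ := by rw [pow_succ] at hj; omega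
      by_cases hpar : j % 2 = 0
      · left
        exact ⟨j / 2, hj2, by rw [fft, if_pos hpar]⟩
      · right
        exact ⟨j / 2, hj2, by rw [fft, if_neg hpar]⟩

end KLevel

end

end Summit.MatrixMultiplication.MatrixMultiplication.Theorems
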